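import Summits.BirchSwinnertonDyer.Rank1Residual.Iwasawa.UnramifiedConditionFiniteOrbit
import Literature.NumberTheory.EllipticCurves.KellerYin2024.AnticyclotomicLocalEulerFactors
import Mathlib.NumberTheory.Padics.RingHoms
import HarnessLib

/-!
# `Γ_K = H · D_v · {γⁿ : n < [Γ : Γ_v]}` — the SHARP representative count `numPlacesAbove κ v`
# for the places of a `ℤ_p`-extension above a finitely decomposed `v`

Cell `bsd-eis` (home `run/shared/lean/pub/bsd-eis/`), seat `bsd-line-x1-p1-w2` (D-0154 width seat on
crux 2 `GoodLatticeBDPValue` = stmt-BirchSwinnertonDyer-19032, line `halves` v14, stub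
`stub_imprimCorank`), step 2 of the unconditional `≤`-direction of the bare `S`-relaxation corank
identities: the representative property `hrep` of
`UnrSelmerQuotientCorankLeGeneric.zpCorank_quotient_le_sum` with the SHARP count
`N_v = KellerYin2024.numPlacesAbove κ v = [Γ : Γ_v]` (the number of places of `K_∞` above `v`, the
factor of `charLocalLambda` / `curveLocalLambda`), instead of the "some `p^m`" of b2b's
`Iwasawa.exists_forall_eq_mul_decomp_mul_pow`.

HONEST FRAMING: tool theorems only (no definition, no named fact, no `sorry`); any number field, any
`ℤ_p`-extension, any finite place `v` finitely decomposed in `K_∞`; closes nothing by itself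
(`--supports stmt-BirchSwinnertonDyer-19032`); BSD / Mazur's main conjecture is proved for no curve.

## What

For a number field `K`, a prime `p`, a `ℤ_p`-extension `κ : Γ_K ↠ ℤ_p` (`H = ker κ`) and a finite
place `v` with decomposition group `D_v` (chosen embedding) such that `κ(D_v) ≠ 1`:

* `exists_valuation_minimal` — some `δ₁ ∈ D_v` has `κ δ₁ ≠ 0` of least valuation `m` among the
  nonzero elements of `κ(D_v) ⊆ ℤ_p`;
* `mem_map_decomp_iff_norm_le` — `κ(D_v)` is then EXACTLY the ball `‖y‖ ≤ ‖κ δ₁‖ = p^{-m}`, i.e.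
  `p^m ℤ_p` (closed subgroups of `ℤ_p`; `⊇` is b2b's `exists_mem_decomp_apply_eq_of_norm_le`);
* **`numPlacesAbove_eq_pow_valuation`** — `numPlacesAbove κ v = [ℤ_p : κ(D_v)] = p^m`
  (`κ(D_v) = ker (ℤ_p ↠ ℤ/p^m)`);
* **`forall_exists_lt_numPlacesAbove`** — every `σ ∈ Γ_K` is `h · (δ · γⁿ)` with `h ∈ H`, `δ ∈ D_v`
  and `n < numPlacesAbove κ v`, for a topological generator `γ` (b2b's factorisation at `δ₁`).

References: Greenberg–Vatsal, Invent. Math. 142 (2000) §2 p. 21 (`s_ℓ` = the number of primes of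
`ℚ_∞` above `ℓ`); Keller–Yin arXiv:2402.12781v2 Lemma 1.0.1 / Lemma 1.1.1 (`[Γ : Γ_w]`);
Washington, *Introduction to Cyclotomic Fields* §13.1 (closed subgroups of `ℤ_p`).
-/

-- `Summit.BirchSwinnertonDyer.BirchSwinnertonDyer.…`: summit and sub-problem share a name (D-0017 layout).
set_option linter.dupNamespace false
set_option autoImplicit false

noncomputable section

open scoped Classical

open NumberField IsDedekindDomain Field
open Literature.NumberTheory.EllipticCurves Literature.NumberTheory.EllipticCurves.GreenbergSelmer
  Literature.NumberTheory.EllipticCurves.KellerYin2024 Literature.NumberTheory.GaloisRepresentations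
  Summit.BirchSwinnertonDyer.Rank1Residual.Iwasawa

namespace Summit.BirchSwinnertonDyer.BirchSwinnertonDyer.Theorems.NumPlacesAboveRepresentatives

variable {K : Type} [Field K] [NumberField K] {p : ℕ} [Fact p.Prime] (κ : ZpExtension K p)
  (v : HeightOneSpectrum (𝓞 K))

/-- **A valuation-minimal element of `κ(D_v)`**: if `κ(D_v) ≠ 1`, some `δ₁ ∈ D_v` has `κ δ₁ ≠ 1`
with `v_p(κ δ₁) ≤ v_p(κ δ)` for every `δ ∈ D_v` with `κ δ ≠ 1` (well-ordering of `ℕ`).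
[folklore] -/
theorem exists_valuation_minimal (hD : ∃ δ ∈ decomp (K := K) v, κ δ ≠ 1) :
    ∃ δ₁ ∈ decomp (K := K) v, κ δ₁ ≠ 1 ∧
      ∀ δ ∈ decomp (K := K) v, κ δ ≠ 1 → ((κ δ₁).toAdd).valuation ≤ ((κ δ).toAdd).valuation := by
  have hex : ∃ m : ℕ, ∃ δ ∈ decomp (K := K) v, κ δ ≠ 1 ∧ ((κ δ).toAdd).valuation = m := by
    obtain ⟨δ, hδ, hne⟩ := hD
    exact ⟨_, δ, hδ, hne, rfl⟩
  obtain ⟨δ₁, hδ₁, hne₁, hval⟩ := Nat.find_spec hex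
  refine ⟨δ₁, hδ₁, hne₁, fun δ hδ hne ↦ ?_⟩
  rw [hval]
  exact Nat.find_min' hex ⟨δ, hδ, hne, rfl⟩

/-- **`κ(D_v)` is the ball `‖y‖ ≤ ‖κ δ₁‖`** for a valuation-minimal `δ₁ ∈ D_v` with `κ δ₁ ≠ 1`
(`⊇`: b2b `exists_mem_decomp_apply_eq_of_norm_le` — `κ(D_v)` is closed and contains `κ(δ₁)^ℤ`;
`⊆`: minimality of the valuation). Washington §13.1 (closed subgroups of `ℤ_p` are `0` or
`p^m ℤ_p`). [cite: Washington1997, §13.1] -/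
theorem mem_map_decomp_iff_norm_le {δ₁ : absoluteGaloisGroup K} (hδ₁ : δ₁ ∈ decomp (K := K) v)
    (hne : κ δ₁ ≠ 1)
    (hmin : ∀ δ ∈ decomp (K := K) v, κ δ ≠ 1 →
      ((κ δ₁).toAdd).valuation ≤ ((κ δ).toAdd).valuation)
    (y : Multiplicative ℤ_[p]) :
    y ∈ (decomp (K := K) v).map κ.toContinuousMonoidHom.toMonoidHom ↔
      ‖y.toAdd‖ ≤ ‖(κ δ₁).toAdd‖ := by
  have hp : (p : ℕ).Prime := Fact.out
  constructor
  · rintro ⟨δ, hδ, rfl⟩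
    change ‖(κ δ).toAdd‖ ≤ ‖(κ δ₁).toAdd‖
    by_cases h1 : κ δ = 1
    · rw [h1, toAdd_one, norm_zero]
      exact norm_nonneg _
    · have ha0 : (κ δ₁).toAdd ≠ 0 := fun h ↦ hne (by rw [← ofAdd_toAdd (κ δ₁), h]; rfl)
      have hb0 : (κ δ).toAdd ≠ 0 := fun h ↦ h1 (by rw [← ofAdd_toAdd (κ δ), h]; rfl)
      rw [PadicInt.norm_eq_zpow_neg_valuation ha0, PadicInt.norm_eq_zpow_neg_valuation hb0]
      have hp1 : (1 : ℝ) ≤ p := by exact_mod_cast hp.one_lt.le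
      exact zpow_le_zpow_right₀ hp1 (by have := hmin δ hδ h1; omega)
  · intro hy
    obtain ⟨δ, hδ, hκδ⟩ := exists_mem_decomp_apply_eq_of_norm_le κ hδ₁ hne hy
    refine ⟨δ, hδ, ?_⟩
    change κ δ = y
    rw [hκδ, ofAdd_toAdd]

/-- **`numPlacesAbove κ v = [ℤ_p : κ(D_v)] = p^m`**, `m = v_p(κ δ₁)` for a valuation-minimal
`δ₁ ∈ D_v` with `κ δ₁ ≠ 1`: by `mem_map_decomp_iff_norm_le`, `κ(D_v) = p^m ℤ_p = ker (ℤ_p ↠ ℤ/p^m)`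
(`PadicInt.ker_toZModPow`, `PadicInt.norm_le_pow_iff_mem_span_pow`), whose index is `#(ℤ/p^m) = p^m`.
This is the number of places of `K_∞` above `v` (KY Lemma 1.1.1's `[Γ : Γ_w]`; GV's `s_ℓ`).
[cite: KellerYin2024, Lemma 1.1.1 (arXiv:2402.12781v2 TeX L455–462)] [cite: GreenbergVatsal2000, §2 p. 21] -/
theorem numPlacesAbove_eq_pow_valuation {δ₁ : absoluteGaloisGroup K} (hδ₁ : δ₁ ∈ decomp (K := K) v)
    (hne : κ δ₁ ≠ 1)
    (hmin : ∀ δ ∈ decomp (K := K) v, κ δ ≠ 1 →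
      ((κ δ₁).toAdd).valuation ≤ ((κ δ).toAdd).valuation) :
    numPlacesAbove κ v = p ^ ((κ δ₁).toAdd).valuation := by
  set m : ℕ := ((κ δ₁).toAdd).valuation with hm
  have ha0 : (κ δ₁).toAdd ≠ 0 := fun h ↦ hne (by rw [← ofAdd_toAdd (κ δ₁), h]; rfl)
  -- the reduction `ℤ_p ↠ ℤ/p^m`, multiplicatively
  let f : Multiplicative ℤ_[p] →* Multiplicative (ZMod (p ^ m)) :=
    (PadicInt.toZModPow m : ℤ_[p] →+* ZMod (p ^ m)).toAddMonoidHom.toMultiplicative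
  have hf : ∀ y : Multiplicative ℤ_[p], f y = Multiplicative.ofAdd (PadicInt.toZModPow m y.toAdd) :=
    fun _ ↦ rfl
  have hker : (decomp (K := K) v).map κ.toContinuousMonoidHom.toMonoidHom = f.ker := by
    ext y
    rw [mem_map_decomp_iff_norm_le κ v hδ₁ hne hmin, MonoidHom.mem_ker, hf,
      PadicInt.norm_eq_zpow_neg_valuation ha0, ← hm, PadicInt.norm_le_pow_iff_mem_span_pow,
      ← PadicInt.ker_toZModPow, RingHom.mem_ker]
    exact ofAdd_eq_one
  have hsurj : Function.Surjective f := fun z ↦ by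
    obtain ⟨x, hx⟩ := ZMod.ringHom_surjective (PadicInt.toZModPow (p := p) m) z.toAdd
    exact ⟨Multiplicative.ofAdd x, by rw [hf, toAdd_ofAdd, hx, ofAdd_toAdd]⟩
  rw [numPlacesAbove_eq, hker, Subgroup.index_ker, MonoidHom.range_eq_top.mpr hsurj,
    Subgroup.card_top, Nat.card_congr Multiplicative.toAdd, Nat.card_zmod]

/-- **`numPlacesAbove κ v` is a power of `p`** when `v` is finitely decomposed in `K_∞`.
[cite: KellerYin2024, Lemma 1.0.1 and Lemma 1.1.1 (arXiv:2402.12781v2)] -/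
theorem exists_numPlacesAbove_eq_pow (hD : ∃ δ ∈ decomp (K := K) v, κ δ ≠ 1) :
    ∃ m : ℕ, numPlacesAbove κ v = p ^ m := by
  obtain ⟨δ₁, hδ₁, hne, hmin⟩ := exists_valuation_minimal κ v hD
  exact ⟨_, numPlacesAbove_eq_pow_valuation κ v hδ₁ hne hmin⟩

/-- `0 < numPlacesAbove κ v` when `v` is finitely decomposed in `K_∞` (the junk value `0` of
`Subgroup.index` is attained only when `v` splits completely).
[cite: KellerYin2024, Lemma 1.0.1 (arXiv:2402.12781v2 TeX L388)] -/
theorem numPlacesAbove_pos (hD : ∃ δ ∈ decomp (K := K) v, κ δ ≠ 1) : 0 < numPlacesAbove κ v := by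
  obtain ⟨m, hm⟩ := exists_numPlacesAbove_eq_pow κ v hD
  rw [hm]
  exact pow_pos (Fact.out : p.Prime).pos m

/-- **`Γ_K = H · D_v · {γⁿ : n < numPlacesAbove κ v}`**: over a `ℤ_p`-extension `κ` with topological
generator `γ`, if `v` is finitely decomposed in `K_∞` (`κ(D_v) ≠ 1`), every `σ ∈ Γ_K` factors as
`σ = h · (δ · γⁿ)` with `h ∈ H = ker κ`, `δ ∈ D_v` and `n < numPlacesAbove κ v = [Γ : Γ_v]` — the
`[Γ : Γ_v]` translates `γⁿ` of the chosen place are ALL the places of `K_∞` above `v`. b2b's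
`exists_forall_eq_mul_decomp_mul_pow` at a valuation-minimal `δ₁`, with `p^{v_p(κ δ₁)}` identified
as `numPlacesAbove κ v`. This is the `hrep` input of
`UnrSelmerQuotientCorankLeGeneric.zpCorank_quotient_le_sum` with the SHARP count.
[cite: GreenbergVatsal2000, §2 p. 21] [cite: KellerYin2024, Lemma 1.1.1 (arXiv:2402.12781v2 TeX L455–462)] -/
theorem forall_exists_lt_numPlacesAbove {γ : absoluteGaloisGroup K} (hγ : κ.IsTopGenerator γ)
    (hD : ∃ δ ∈ decomp (K := K) v, κ δ ≠ 1) (σ : absoluteGaloisGroup K) :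
    ∃ n < numPlacesAbove κ v, ∃ δ ∈ decomp (K := K) v, ∃ h ∈ κ.kerSubgroup,
      σ = h * (δ * γ ^ n) := by
  obtain ⟨δ₁, hδ₁, hne, hmin⟩ := exists_valuation_minimal κ v hD
  rw [numPlacesAbove_eq_pow_valuation κ v hδ₁ hne hmin]
  -- b2b's factorisation at `δ₁` uses exactly the exponent `v_p(κ δ₁)`
  set a : ℤ_[p] := (κ δ₁).toAdd with ha
  have ha0 : a ≠ 0 := fun h ↦ hne (by rw [← ofAdd_toAdd (κ δ₁), ← ha, h]; rfl)
  set x : ℤ_[p] := (κ σ).toAdd with hx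
  refine ⟨x.appr a.valuation, PadicInt.appr_lt x _, ?_⟩
  have hy : ‖x - (x.appr a.valuation : ℤ_[p])‖ ≤ ‖a‖ := by
    rw [PadicInt.norm_eq_zpow_neg_valuation ha0, PadicInt.norm_le_pow_iff_mem_span_pow]
    exact PadicInt.appr_spec _ x
  obtain ⟨δ, hδ, hκδ⟩ := exists_mem_decomp_apply_eq_of_norm_le κ hδ₁ hne hy
  refine ⟨δ, hδ, σ * (δ * γ ^ (x.appr a.valuation))⁻¹, ?_, by rw [inv_mul_cancel_right]⟩
  rw [ZpExtension.mem_kerSubgroup, map_mul, map_inv, map_mul, map_pow, hκδ, hγ,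
    mul_inv_eq_one, ← ofAdd_toAdd (κ σ), ← hx, ← ofAdd_nsmul, ← ofAdd_add, nsmul_one,
    sub_add_cancel]

end Summit.BirchSwinnertonDyer.BirchSwinnertonDyer.Theorems.NumPlacesAboveRepresentatives

end
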